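import Summits.AnomalousDissipation.AnomalousDissipation.Theorems.SoloBlindMomentumFlux
import Literature.Analysis.FluidPDE.ClassicalNSFourierModes
import Literature.Analysis.FluidPDE.AlexakisDoeringInterpolation

/-!
# Solo (blind) — the flux-moment identities along time-dependent classical solutions

The steady identities of `SoloBlindMomentumFlux` are the time-independent cases of three exact
ODEs along ANY global classical solution `u` of the Kolmogorov-forced Navier–Stokes system
`∂ₜu + (u·∇)u = νΔu − ∇p + f`, `f = cos(2πx₃)e₁`, on `𝕋³` (tested momentum equation,
`Torus.IsClassicalNSSolutionOn.hasDerivWithinAt_integral_inner`, with the test fields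
`g = sin(2πx₃)e₁`, `f`, and the constant `e₃`):

* `d/dt ∫u₃ = 0` (`hasDerivAt_crossMomentum`; the cross-layer momentum `m₃` is conserved);
* `d/dt ∫⟪g, u⟫ = 2π ∫u₃⟪f, u⟫ − 4π²ν ∫⟪g, u⟫` (`hasDerivAt_sinMoment`);
* `d/dt ∫⟪f, u⟫ = ½ − 2π ∫u₃⟪g, u⟫ − 4π²ν ∫⟪f, u⟫` (`hasDerivAt_work`).

Integrated over `[0, T]` (`sinMoment_sub_eq`, `work_sub_eq`) they give the TIME-AVERAGED WORK
FORMULA with explicit `O(1)` boundary terms (`work_formula_timeAvg`):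

  `2π (m₃² + 4π²ν²) ∫₀ᵀ W = πν T − 4π²ν ∫₀ᵀ Φ_s − 2π m₃ ∫₀ᵀ Φ_c − 2πν [W]₀ᵀ + m₃ [S]₀ᵀ`,

`W(t) = ∫⟪f, u(t)⟫` (injected power), `S(t) = ∫⟪g, u(t)⟫`, `Φ_s(t) = ∫ (u₃ − m₃)⟪g, u⟫`,
`Φ_c(t) = ∫ (u₃ − m₃)⟪f, u⟫`; and the PINNING INEQUALITY (`abs_inphase_timeAvg_sub_le`): if
`∫‖u(t)‖² ≤ R` for `t ≥ 0` then `|2π ∫₀ᵀ ∫u₃⟪g,u⟫ dt − T/2| ≤ 4π²ν T √(R/2) + 2 √(R/2)`, i.e. the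
long-time mean of the Reynolds-stress moment `∫ u₁u₃ sin(2πx₃)` of EVERY bounded-energy global
classical solution is `1/(4π) + O(ν√R) + O(√R/T)`. Since classical solutions are Leray–Hopf
solutions with energy equality, this is the time-dependent form of "what a proof of the zeroth
law for the Kolmogorov force must do": at `m₃ = 0`, keep the pinning defect of order exactly `ν`.
The long-time mean of the quadrature and in-phase identities is the mean momentum budget of the
turbulent Kolmogorov flow, `F = S/L + νU/L²` in the notation of Musacchio–Boffetta.
[folklore; cite: Temam1984, Ch. III §1 (1.13) (tested momentum equation);
cite: MusacchioBoffetta2014, §2 eq. (2.4) (mean momentum budget of the Kolmogorov flow)]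
-/

open MeasureTheory Filter Topology Set UnitAddTorus
open scoped ENNReal NNReal ComplexConjugate InnerProductSpace

noncomputable section

namespace Summit.AnomalousDissipation.AnomalousDissipation.Theorems

open Literature.Analysis.FunctionSpaces Literature.Analysis.FunctionSpaces.Torus
open Literature.Analysis.FluidPDE

/-! ### The constant test field `e₃` -/

/-- The unit vector `e₃`. [folklore] -/
def e3Vec : EuclideanSpace ℝ (Fin 3) := EuclideanSpace.single 2 1

/-- The constant field `e₃`, as a trigonometric polynomial on the single frequency `0`.
[folklore] -/
def e3Field : UnitAddTorus (Fin 3) → EuclideanSpace ℝ (Fin 3) :=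
  realTrigPoly {0} fun _ => EuclideanSpace.complexify e3Vec

/-- `e3Field` is the constant `e₃`. [folklore] -/
theorem e3Field_apply (x : UnitAddTorus (Fin 3)) : e3Field x = e3Vec := by
  rw [e3Field, realTrigPoly_singleton_apply, mFourier_zero, ContinuousMap.one_apply, one_smul,
    EuclideanSpace.realPart_complexify]

/-- `⟪e₃, v⟫ = v₃`. [folklore] -/
theorem inner_e3Vec_left (v : EuclideanSpace ℝ (Fin 3)) : ⟪e3Vec, v⟫_ℝ = v 2 := by
  rw [e3Vec, EuclideanSpace.inner_single_left]
  simp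

/-- The constant field is smooth. [folklore] -/
theorem isSmooth_e3Field : IsSmooth e3Field := isSmooth_realTrigPoly _ _

/-- The constant field is divergence free. [folklore] -/
theorem isDivFree_e3Field : IsDivFree e3Field := isDivFree_realTrigPoly_singleton (by simp)

/-- The constant field has vanishing partial derivatives. [folklore] -/
theorem partialDeriv_e3Field (i : Fin 3) (y : UnitAddTorus (Fin 3)) :
    partialDeriv i e3Field y = 0 := by
  rw [e3Field, partialDeriv_realTrigPoly,
    realTrigPoly_congr (c' := 0) fun k hk => by simp [Finset.mem_singleton.1 hk],
    realTrigPoly_zero, Pi.zero_apply]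

/-- The constant field is harmonic. [folklore] -/
theorem laplacian_e3Field (y : UnitAddTorus (Fin 3)) : Torus.laplacian e3Field y = 0 := by
  rw [e3Field, laplacian_realTrigPoly_singleton, freqNormSq_zero]
  simp

/-- Advection of a constant field vanishes. [folklore] -/
theorem convect_e3Field (U : UnitAddTorus (Fin 3) → EuclideanSpace ℝ (Fin 3))
    (y : UnitAddTorus (Fin 3)) : Torus.convect U e3Field y = 0 := by
  have h1 : IsContDiff 1 e3Field := isSmooth_e3Field.isContDiff (by simp)
  rw [Torus.convect, fderiv_apply_eq_sum_partialDeriv h1]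
  simp [partialDeriv_e3Field]

/-- The Kolmogorov force has no `e₃`-moment: `∫⟪f, e₃⟫ = 0`. [folklore] -/
theorem integral_inner_kolForce_e3Field : ∫ x, ⟪kolForce x, e3Field x⟫_ℝ = 0 := by
  have h1 : (fun x => ⟪kolForce x, e3Field x⟫_ℝ) = fun x => ⟪e3Vec, kolForce x⟫_ℝ := by
    funext x
    rw [e3Field_apply, real_inner_comm]
  have h0 : ∫ x, kolForce x = 0 := hasZeroMean_kolForce
  rw [h1, integral_inner isSmooth_kolForce.integrable, h0, inner_zero_right]

/-! ### The three ODEs along a global classical solution -/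

variable {ν : ℝ} {u : ℝ → UnitAddTorus (Fin 3) → EuclideanSpace ℝ (Fin 3)}
  {p : ℝ → UnitAddTorus (Fin 3) → ℝ}

/-- **Conservation of cross-layer momentum**: `d/dt ∫ u₃ = 0` along every global classical
solution of the Kolmogorov-forced system (test with the constant `e₃`; `∫⟪f, e₃⟫ = 0`).
[folklore; cite: Temam1984, Ch. III §1 (1.13)] -/
theorem hasDerivAt_crossMomentum
    (h : Torus.IsClassicalNSSolutionOn univ ν (fun _ => kolForce) u p) (t : ℝ) :
    HasDerivAt (fun s => ∫ x, u s x 2) 0 t := by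
  have hD := h.hasDerivWithinAt_integral_inner convex_univ uniqueDiffOn_univ isSmooth_e3Field
    isDivFree_e3Field (mem_univ t)
  have hfun : (fun s => ∫ x, ⟪u s x, e3Field x⟫_ℝ) = fun s => ∫ x, u s x 2 := by
    funext s
    refine integral_congr_ae (ae_of_all _ fun x => ?_)
    dsimp only
    rw [e3Field_apply, real_inner_comm, inner_e3Vec_left]
  have hval : (∫ x, ⟪u t x, Torus.convect (u t) e3Field x⟫_ℝ) +
      ν * (∫ x, ⟪u t x, Torus.laplacian e3Field x⟫_ℝ) +
        ∫ x, ⟪kolForce x, e3Field x⟫_ℝ = 0 := by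
    simp_rw [convect_e3Field, laplacian_e3Field, inner_zero_right, integral_zero]
    rw [integral_inner_kolForce_e3Field]
    ring
  rw [← hfun]
  exact (hasDerivWithinAt_univ.1 hD).congr_deriv hval

/-- The cross-layer momentum is constant in time: `∫ u₃(t) = ∫ u₃(0)`. [folklore] -/
theorem crossMomentum_eq (h : Torus.IsClassicalNSSolutionOn univ ν (fun _ => kolForce) u p)
    (t : ℝ) : ∫ x, u t x 2 = ∫ x, u 0 x 2 :=
  is_const_of_deriv_eq_zero (fun s => (hasDerivAt_crossMomentum h s).differentiableAt)
    (fun s => (hasDerivAt_crossMomentum h s).deriv) t 0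

/-- **The quadrature ODE**: `d/dt ∫⟪g, u⟫ = 2π ∫ u₃⟪f, u⟫ − 4π²ν ∫⟪g, u⟫`.
[folklore; cite: Temam1984, Ch. III §1 (1.13)] -/
theorem hasDerivAt_sinMoment
    (h : Torus.IsClassicalNSSolutionOn univ ν (fun _ => kolForce) u p) (t : ℝ) :
    HasDerivAt (fun s => ∫ x, ⟪kolSin x, u s x⟫_ℝ)
      (2 * Real.pi * (∫ x, u t x 2 * ⟪kolForce x, u t x⟫_ℝ) -
        4 * Real.pi ^ 2 * ν * ∫ x, ⟪kolSin x, u t x⟫_ℝ) t := by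
  have hD := h.hasDerivWithinAt_integral_inner convex_univ uniqueDiffOn_univ isSmooth_kolSin
    isDivFree_kolSin (mem_univ t)
  have hfun : (fun s => ∫ x, ⟪u s x, kolSin x⟫_ℝ) = fun s => ∫ x, ⟪kolSin x, u s x⟫_ℝ := by
    funext s
    refine integral_congr_ae (ae_of_all _ fun x => ?_)
    dsimp only
    rw [real_inner_comm]
  rw [integral_inner_convect_kolSin, integral_inner_laplacian_kolSin,
    integral_inner_kolForce_kolSin, hfun] at hD
  refine (hasDerivWithinAt_univ.1 hD).congr_deriv ?_
  ring

/-- **The work ODE**: `d/dt ∫⟪f, u⟫ = ½ − 2π ∫ u₃⟪g, u⟫ − 4π²ν ∫⟪f, u⟫`.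
[folklore; cite: Temam1984, Ch. III §1 (1.13)] -/
theorem hasDerivAt_work
    (h : Torus.IsClassicalNSSolutionOn univ ν (fun _ => kolForce) u p) (t : ℝ) :
    HasDerivAt (fun s => ∫ x, ⟪kolForce x, u s x⟫_ℝ)
      (1 / 2 - 2 * Real.pi * (∫ x, u t x 2 * ⟪kolSin x, u t x⟫_ℝ) -
        4 * Real.pi ^ 2 * ν * ∫ x, ⟪kolForce x, u t x⟫_ℝ) t := by
  have hD := h.hasDerivWithinAt_integral_inner convex_univ uniqueDiffOn_univ isSmooth_kolForce
    isDivFree_kolForce (mem_univ t)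
  have hfun : (fun s => ∫ x, ⟪u s x, kolForce x⟫_ℝ) = fun s => ∫ x, ⟪kolForce x, u s x⟫_ℝ := by
    funext s
    refine integral_congr_ae (ae_of_all _ fun x => ?_)
    dsimp only
    rw [real_inner_comm]
  rw [integral_inner_convect_kolForce, integral_inner_laplacian_kolForce,
    integral_inner_kolForce_self, hfun] at hD
  refine (hasDerivWithinAt_univ.1 hD).congr_deriv ?_
  ring

/-! ### Continuity of the moments in time -/

/-- The moments `t ↦ ∫ u₃ ⟪F, u⟫` (`F` a fixed smooth field) are continuous. [folklore] -/
theorem continuous_fluxMoment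
    (h : Torus.IsClassicalNSSolutionOn univ ν (fun _ => kolForce) u p)
    {F : UnitAddTorus (Fin 3) → EuclideanSpace ℝ (Fin 3)} (hF : IsSmooth F) :
    Continuous fun t => ∫ x, u t x 2 * ⟪F x, u t x⟫_ℝ := by
  have hu := h.smooth_velocity
  have hF' : IsSmoothSpaceTimeOn univ (fun _ : ℝ => F) := isSmoothSpaceTimeOn_const hF _
  have hst : IsSmoothSpaceTimeOn univ (fun t x => u t x 2 * ⟪F x, u t x⟫_ℝ) :=
    (hu.apply 2).mul (hF'.inner hu)
  exact continuousOn_univ.1 (hst.continuousOn_integral convex_univ)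

/-- The pairings `t ↦ ∫ ⟪F, u⟫` (`F` a fixed smooth field) are continuous. [folklore] -/
theorem continuous_pairing
    (h : Torus.IsClassicalNSSolutionOn univ ν (fun _ => kolForce) u p)
    {F : UnitAddTorus (Fin 3) → EuclideanSpace ℝ (Fin 3)} (hF : IsSmooth F) :
    Continuous fun t => ∫ x, ⟪F x, u t x⟫_ℝ := by
  have hu := h.smooth_velocity
  have hF' : IsSmoothSpaceTimeOn univ (fun _ : ℝ => F) := isSmoothSpaceTimeOn_const hF _
  exact continuousOn_univ.1 ((hF'.inner hu).continuousOn_integral convex_univ)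

/-! ### The integrated identities on `[0, T]` -/

/-- **Integrated quadrature identity**:
`S(T) − S(0) = 2π ∫₀ᵀ ∫u₃⟪f,u⟫ − 4π²ν ∫₀ᵀ S`, `S(t) = ∫⟪g, u(t)⟫`. [folklore] -/
theorem sinMoment_sub_eq
    (h : Torus.IsClassicalNSSolutionOn univ ν (fun _ => kolForce) u p) (T : ℝ) :
    (∫ x, ⟪kolSin x, u T x⟫_ℝ) - ∫ x, ⟪kolSin x, u 0 x⟫_ℝ =
      2 * Real.pi * (∫ t in (0 : ℝ)..T, ∫ x, u t x 2 * ⟪kolForce x, u t x⟫_ℝ) -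
        4 * Real.pi ^ 2 * ν * ∫ t in (0 : ℝ)..T, ∫ x, ⟪kolSin x, u t x⟫_ℝ := by
  have hB := (continuous_fluxMoment h isSmooth_kolForce).intervalIntegrable (μ := volume) 0 T
  have hS := (continuous_pairing h isSmooth_kolSin).intervalIntegrable (μ := volume) 0 T
  have hFTC := intervalIntegral.integral_eq_sub_of_hasDerivAt
    (fun t _ => hasDerivAt_sinMoment h t) ((hB.const_mul _).sub (hS.const_mul _))
  rw [intervalIntegral.integral_sub (hB.const_mul _) (hS.const_mul _),
    intervalIntegral.integral_const_mul, intervalIntegral.integral_const_mul] at hFTC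
  linarith

/-- **Integrated work identity**:
`W(T) − W(0) = T/2 − 2π ∫₀ᵀ ∫u₃⟪g,u⟫ − 4π²ν ∫₀ᵀ W`, `W(t) = ∫⟪f, u(t)⟫`. [folklore] -/
theorem work_sub_eq
    (h : Torus.IsClassicalNSSolutionOn univ ν (fun _ => kolForce) u p) (T : ℝ) :
    (∫ x, ⟪kolForce x, u T x⟫_ℝ) - ∫ x, ⟪kolForce x, u 0 x⟫_ℝ =
      T / 2 - 2 * Real.pi * (∫ t in (0 : ℝ)..T, ∫ x, u t x 2 * ⟪kolSin x, u t x⟫_ℝ) -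
        4 * Real.pi ^ 2 * ν * ∫ t in (0 : ℝ)..T, ∫ x, ⟪kolForce x, u t x⟫_ℝ := by
  have hA := (continuous_fluxMoment h isSmooth_kolSin).intervalIntegrable (μ := volume) 0 T
  have hW := (continuous_pairing h isSmooth_kolForce).intervalIntegrable (μ := volume) 0 T
  have hc : IntervalIntegrable (fun _ : ℝ => (1 / 2 : ℝ)) volume 0 T := intervalIntegrable_const
  have hFTC := intervalIntegral.integral_eq_sub_of_hasDerivAt
    (fun t _ => hasDerivAt_work h t) ((hc.sub (hA.const_mul _)).sub (hW.const_mul _))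
  rw [intervalIntegral.integral_sub (hc.sub (hA.const_mul _)) (hW.const_mul _),
    intervalIntegral.integral_sub hc (hA.const_mul _), intervalIntegral.integral_const,
    intervalIntegral.integral_const_mul, intervalIntegral.integral_const_mul] at hFTC
  simp only [sub_zero, smul_eq_mul] at hFTC
  linarith

/-- **Time-averaged work formula** (exact, with boundary terms). Along every global classical
solution of the Kolmogorov-forced system, with conserved cross-layer momentum `m₃ = ∫u₃(0)`,
`W(t) = ∫⟪f,u(t)⟫`, `S(t) = ∫⟪g,u(t)⟫`, `Φ_s(t) = ∫(u₃ − m₃)⟪g,u⟫`, `Φ_c(t) = ∫(u₃ − m₃)⟪f,u⟫`: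

  `2π (m₃² + 4π²ν²) ∫₀ᵀ W = πν T − 4π²ν ∫₀ᵀ Φ_s − 2π m₃ ∫₀ᵀ Φ_c − 2πν (W(T) − W(0))`
  `+ m₃ (S(T) − S(0))`.

Dividing by `T → ∞` at bounded energy: `⟨W⟩ (m₃² + 4π²ν²) = ν/2 − 2πν⟨Φ_s⟩ − m₃⟨Φ_c⟩` in the mean,
exactly as for steady states (`work_formula`). [folklore] -/
theorem work_formula_timeAvg
    (h : Torus.IsClassicalNSSolutionOn univ ν (fun _ => kolForce) u p) (T : ℝ) :
    2 * Real.pi * ((∫ x, u 0 x 2) ^ 2 + 4 * Real.pi ^ 2 * ν ^ 2) *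
        (∫ t in (0 : ℝ)..T, ∫ x, ⟪kolForce x, u t x⟫_ℝ) =
      Real.pi * ν * T
        - 4 * Real.pi ^ 2 * ν *
            (∫ t in (0 : ℝ)..T, ∫ x, (u t x 2 - ∫ y, u 0 y 2) * ⟪kolSin x, u t x⟫_ℝ)
        - 2 * Real.pi * (∫ x, u 0 x 2) *
            (∫ t in (0 : ℝ)..T, ∫ x, (u t x 2 - ∫ y, u 0 y 2) * ⟪kolForce x, u t x⟫_ℝ)
        - 2 * Real.pi * ν * ((∫ x, ⟪kolForce x, u T x⟫_ℝ) - ∫ x, ⟪kolForce x, u 0 x⟫_ℝ)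
        + (∫ x, u 0 x 2) * ((∫ x, ⟪kolSin x, u T x⟫_ℝ) - ∫ x, ⟪kolSin x, u 0 x⟫_ℝ) := by
  have hu := h.smooth_velocity
  set m : ℝ := ∫ x, u 0 x 2 with hm
  -- split the fluctuation moments pointwise in time
  have hs : (fun t => ∫ x, (u t x 2 - m) * ⟪kolSin x, u t x⟫_ℝ) =
      fun t => (∫ x, u t x 2 * ⟪kolSin x, u t x⟫_ℝ) - m * ∫ x, ⟪kolSin x, u t x⟫_ℝ := by
    funext t
    have hut : IsSmooth (u t) := hu.isSmooth_slice (mem_univ t)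
    exact integral_fluct_mul hut (isSmooth_kolSin.inner hut) m
  have hc : (fun t => ∫ x, (u t x 2 - m) * ⟪kolForce x, u t x⟫_ℝ) =
      fun t => (∫ x, u t x 2 * ⟪kolForce x, u t x⟫_ℝ) - m * ∫ x, ⟪kolForce x, u t x⟫_ℝ := by
    funext t
    have hut : IsSmooth (u t) := hu.isSmooth_slice (mem_univ t)
    exact integral_fluct_mul hut (isSmooth_kolForce.inner hut) m
  have hA := (continuous_fluxMoment h isSmooth_kolSin).intervalIntegrable (μ := volume) 0 T
  have hB := (continuous_fluxMoment h isSmooth_kolForce).intervalIntegrable (μ := volume) 0 T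
  have hS := (continuous_pairing h isSmooth_kolSin).intervalIntegrable (μ := volume) 0 T
  have hW := (continuous_pairing h isSmooth_kolForce).intervalIntegrable (μ := volume) 0 T
  rw [hs, hc, intervalIntegral.integral_sub hA (hS.const_mul m),
    intervalIntegral.integral_sub hB (hW.const_mul m), intervalIntegral.integral_const_mul,
    intervalIntegral.integral_const_mul]
  have hI := sinMoment_sub_eq h T
  have hII := work_sub_eq h T
  linear_combination (2 * Real.pi * ν) * hII + (-m) * hI

/-! ### Pinning of the in-phase flux in the mean -/

/-- Cauchy–Schwarz for the work of the Kolmogorov force: `|∫⟪f, U⟫| ≤ √(1/2) √(∫‖U‖²)`.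
[folklore] -/
theorem abs_work_le {U : UnitAddTorus (Fin 3) → EuclideanSpace ℝ (Fin 3)} (hU : IsSmooth U) :
    |∫ x, ⟪kolForce x, U x⟫_ℝ| ≤ Real.sqrt (1 / 2) * Real.sqrt (∫ x, ‖U x‖ ^ 2) := by
  have hE : Integrable (fun x => ‖kolForce x‖ ^ 2) volume :=
    ((isSmooth_kolForce.continuous.norm).pow 2).integrable_of_hasCompactSupport
      (HasCompactSupport.of_compactSpace _)
  have hL : Integrable (fun x => ‖U x‖ ^ 2) volume :=
    ((hU.continuous.norm).pow 2).integrable_of_hasCompactSupport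
      (HasCompactSupport.of_compactSpace _)
  have hG : AEStronglyMeasurable (fun x => |⟪kolForce x, U x⟫_ℝ|) volume :=
    (isSmooth_kolForce.inner hU).continuous.abs.aestronglyMeasurable
  rw [← integral_norm_sq_kolForce, ← Real.sqrt_mul (integral_nonneg fun x => sq_nonneg _)]
  refine abs_integral_le_integral_abs.trans
    (integral_le_sqrt_integral_mul_integral (ae_of_all _ fun x => abs_nonneg _)
      (ae_of_all _ fun x => sq_nonneg _) (ae_of_all _ fun x => sq_nonneg _)
      (ae_of_all _ fun x => ?_) hG hE hL)
  dsimp only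
  rw [← mul_pow]
  exact pow_le_pow_left₀ (abs_nonneg _) (abs_real_inner_le_norm _ _) 2

/-- **Pinning inequality.** Along every global classical solution of the Kolmogorov-forced
system whose energy stays bounded, `∫‖u(t)‖² ≤ R` for `t ≥ 0`, the time-integrated in-phase
flux moment is pinned: `|2π ∫₀ᵀ ∫u₃⟪g,u⟫ − T/2| ≤ 4π²ν T √(1/2)√R + 2 √(1/2)√R` (`T ≥ 0`).
Hence the long-time mean of `∫ u₁u₃ sin(2πx₃)` is `1/(4π) + O(ν√R) + O(√R/T)` for EVERY such
solution, at any viscosity: a dissipation floor is a statement about the `O(ν)` defect only.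
[folklore] -/
theorem abs_inphase_timeAvg_sub_le
    (h : Torus.IsClassicalNSSolutionOn univ ν (fun _ => kolForce) u p) (hν : 0 ≤ ν)
    {R : ℝ} (hR : ∀ t, 0 ≤ t → ∫ x, ‖u t x‖ ^ 2 ≤ R) {T : ℝ} (hT : 0 ≤ T) :
    |2 * Real.pi * (∫ t in (0 : ℝ)..T, ∫ x, u t x 2 * ⟪kolSin x, u t x⟫_ℝ) - T / 2| ≤
      4 * Real.pi ^ 2 * ν * T * (Real.sqrt (1 / 2) * Real.sqrt R) +
        2 * (Real.sqrt (1 / 2) * Real.sqrt R) := by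
  have hu := h.smooth_velocity
  set M : ℝ := Real.sqrt (1 / 2) * Real.sqrt R with hM
  have hM0 : 0 ≤ M := by positivity
  have hWt : ∀ t, 0 ≤ t → |∫ x, ⟪kolForce x, u t x⟫_ℝ| ≤ M := fun t ht =>
    (abs_work_le (hu.isSmooth_slice (mem_univ t))).trans
      (mul_le_mul_of_nonneg_left (Real.sqrt_le_sqrt (hR t ht)) (Real.sqrt_nonneg _))
  have hIW : |∫ t in (0 : ℝ)..T, ∫ x, ⟪kolForce x, u t x⟫_ℝ| ≤ M * T := by
    have hI : ‖∫ t in (0 : ℝ)..T, ∫ x, ⟪kolForce x, u t x⟫_ℝ‖ ≤ M * |T - 0| :=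
      intervalIntegral.norm_integral_le_of_norm_le_const fun t ht => by
        rw [uIoc_of_le hT] at ht
        rw [Real.norm_eq_abs]
        exact hWt t ht.1.le
    rwa [sub_zero, abs_of_nonneg hT, Real.norm_eq_abs] at hI
  have hII := work_sub_eq h T
  have hWT := hWt T hT
  have hW0 := hWt 0 le_rfl
  have hkey : 2 * Real.pi * (∫ t in (0 : ℝ)..T, ∫ x, u t x 2 * ⟪kolSin x, u t x⟫_ℝ) - T / 2 =
      -(4 * Real.pi ^ 2 * ν * ∫ t in (0 : ℝ)..T, ∫ x, ⟪kolForce x, u t x⟫_ℝ) -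
        ((∫ x, ⟪kolForce x, u T x⟫_ℝ) - ∫ x, ⟪kolForce x, u 0 x⟫_ℝ) := by
    linarith
  have hπ : 0 ≤ 4 * Real.pi ^ 2 * ν := by positivity
  have hcI : |4 * Real.pi ^ 2 * ν * ∫ t in (0 : ℝ)..T, ∫ x, ⟪kolForce x, u t x⟫_ℝ| ≤
      4 * Real.pi ^ 2 * ν * (M * T) := by
    rw [abs_mul, abs_of_nonneg hπ]
    exact mul_le_mul_of_nonneg_left hIW hπ
  obtain ⟨h1, h2⟩ := abs_le.1 hcI
  obtain ⟨h3, h4⟩ := abs_le.1 hWT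
  obtain ⟨h5, h6⟩ := abs_le.1 hW0
  rw [hkey, abs_le]
  constructor <;> linarith

end Summit.AnomalousDissipation.AnomalousDissipation.Theorems
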